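import Summits.BirchSwinnertonDyer.BirchSwinnertonDyer.Theorems.SylvesterTwoHeegnerIndexCoupledDescentCebotarevRankTwo
import Summits.BirchSwinnertonDyer.BirchSwinnertonDyer.Theorems.SylvesterTwoHeegnerIndexCoupledDualitySylvesterPair
import Summits.BirchSwinnertonDyer.BirchSwinnertonDyer.Theorems.SylvesterTwoHeegnerIndexCoupledDescentPrimitivity
import HarnessLib

/-!
# FIRST LAYER of VARIANT K at the HSY pair ⟸ the height display + leaf (L1) ALONE

Crux `UpperOffV0HSYPlus` (stmt-BirchSwinnertonDyer-19804), stubs `stub_firstLayerFour/Seven`.  The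
kernel deduction of THEOREM K2 (`selmerGroup_eq_bot_and_le_closure_of_coupledLeaves`, p620148) and its
Ш-currency (`…ShaCurrency`, p621108) take five leaf binders (L1), (L2A), (L2B), (L3a), (L3b), an
operator `w` over `g`, and the non-divisibility of the bottom point.  As of today four leaves and all
side data are tree theorems at the HSY pair `(A, B) = (E_{3p²}, E_p)`, `p ≡ 1 (3)`, `K ∋ ω` quadratic:
(L2A/B) `SylvesterTwoCoupledDuality.hL2_cubeSumCurve` (p643067, unconditional: Poitou–Tate is cn100's
theorem), (L3a) `infinite_kolyvaginPrimes_ne_sylvesterPair` (p635187), (L3b)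
`exists_cmH1_infinite_kolyvaginPrimes_line_sylvesterPair_of_rank` (p640670; supplies `w = H¹([ζ])` with
its `[ζ]`-package, whence `g`, `hw` by `torsionH1ToH1_resH1Hom_id`), non-divisibility from the display
by Thm B′ bookkeeping (`not_exists_two_smul_eq_of_padicValRat_eq`, p622469) transported to the short
model, `rank_ℤ E_p(K) = 2` transported by `mordellWeilRank_cubeSumCurve_of_variableChange`.

`natCard_primaryComponent_sha_eq_one_pair_of_display_of_L1`: for `ℚ`-models `A, B`
(`CA • A = cubeSumCurve (3p²)`, `CB • B = cubeSumCurve p`), a height display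
`q·ĥ(ιP) = 2^i·ĥ(Y)` on `B` with `ord₂ q = i` (HSY Thm 1.4 / Cor 4.4 shape: `P` a `ℚ`-generator,
`rank_ℤ B(K) = 2`), levels `N_A, N_B` divisible by the conductors, and leaf (L1) ALONE — coupled
Kolyvagin classes `c_A(ℓ) ∈ H¹(K, E_{3p²}[2])`, `c_B(ℓℓ′) ∈ H¹(K, E_p[2])` Selmer off their level with
the two FLIP criteria at `λ`, for the Kolyvagin-prime predicate of the (L3) files and the bottom class
`δY₀`, `Y₀` = the transport of `Y` to `E_p(K)` — one has `#Ш(B/ℚ)[2^∞] = #Ш(A/ℚ)[2^∞] = 1`.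
So `stub_firstLayerFour` now displays EXACTLY: the height display naming its point, (L1), and the two
conductor divisibilities.  Theorem-only; nothing asserted on 19804; no label moves; BSD not claimed.
-/

set_option linter.dupNamespace false -- Summits modules are `Summit.<Summit>.<Problem>…` by design

noncomputable section

open scoped Classical
open WeierstrassCurve WeierstrassCurve.Affine WeierstrassCurve.Affine.Point NumberField IsDedekindDomain
open Field Literature.NumberTheory.EllipticCurves Literature.NumberTheory.GaloisRepresentations
open Literature.NumberTheory.EllipticCurves.HuShuYin2019

namespace Summit.BirchSwinnertonDyer.BirchSwinnertonDyer.Theorems.SylvesterTwoCoupledDescentCebotarev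

open SylvesterTwoCoupledDescentAtTwo SylvesterTwoCoupledDescentShaCurrency
  SylvesterTwoCoupledDescentPrimitivity SylvesterTwoCoupledDuality

variable {K : Type} [Field K] [NumberField K]

/-- **FIRST LAYER at the HSY pair from the height display and leaf (L1) alone.**  Frame: `K ∋ ω`
quadratic (`ω² + ω + 1 = 0`), `p ≡ 1 (3)` prime, `ℚ`-models `A, B` of `E_{3p²}, E_p`
(`CA • A = cubeSumCurve (3p²)`, `CB • B = cubeSumCurve p`); display on `B`: `P ∈ B(ℚ)` a generator
modulo torsion, non-torsion in `B(K)`, `rank_ℤ B(K) = 2`, `Y ∈ B(K)`, `q ≠ 0`, `q·ĥ(ιP) = 2^i·ĥ(Y)`,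
`ord₂ q = i`; levels `N_A, N_B ≠ 0` divisible by the conductors of the short models; `Y₀ ∈ E_p(K)` the
transport of `Y`; and (L1): coupled classes with the FLIP criteria for the bottom class `δY₀` and the
Kolyvagin primes `ℓ` (`ℓ ∤ 2 N_A N_B d_K`, `(ℓ)` inert, `Frob ℓ = Frob ∞` on `K(E_{3p²}[2])` and on
`K(E_p[2])`).  Then `#Ш(B/ℚ)[2^∞] = 1` and `#Ш(A/ℚ)[2^∞] = 1`. -/
theorem natCard_primaryComponent_sha_eq_one_pair_of_display_of_L1 [NeZero (2 : ℚ)]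
    (h2 : Module.finrank ℚ K = 2) {ω : K} (hω : ω ^ 2 + ω + 1 = 0) {p : ℕ} (hp : p.Prime)
    (hp3 : p % 3 = 1) (A B : WeierstrassCurve ℚ) [A.IsElliptic] [B.IsElliptic]
    (CA CB : VariableChange ℚ) (hCA : CA • A = cubeSumCurve (3 * (p : ℚ) ^ 2))
    (hCB : CB • B = cubeSumCurve (p : ℚ)) (hrank : (B.baseChange K).mordellWeilRank = 2)
    {P : B.toAffine.Point} (hP : ¬IsOfFinAddOrder (WeierstrassCurve.QuadraticDescent.incl K B P))
    (hgen : ∀ Q : B.toAffine.Point, ∃ m : ℤ, IsOfFinAddOrder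
      (WeierstrassCurve.QuadraticDescent.incl K B Q - m • WeierstrassCurve.QuadraticDescent.incl K B P))
    (Y : (B.baseChange K).toAffine.Point) {q : ℚ} (hq : q ≠ 0) {i : ℤ}
    (hid : (q : ℝ) * canonicalHeight (WeierstrassCurve.QuadraticDescent.incl K B P) =
      (2 : ℝ) ^ i * canonicalHeight Y) (hv : padicValRat 2 q = i)
    {NA NB : ℕ} [NeZero NA] [NeZero NB]
    (hNA : (cubeSumCurve (3 * (p : ℚ) ^ 2)).conductorNorm ℤ ∣ NA)
    (hNB : (cubeSumCurve (p : ℚ)).conductorNorm ℤ ∣ NB)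
    (Y₀ : ((cubeSumCurve (p : ℚ)).baseChange K).toAffine.Point)
    (hY₀ : Y₀ = Affine.Point.congrEquiv (congrArg (fun W : WeierstrassCurve ℚ ↦ W.baseChange K) hCB)
      (VariableChange.pointEquivBaseChange B CB K Y))
    (hL1 : ∃ (cA : ℕ → galH1Torsion ((cubeSumCurve (3 * (p : ℚ) ^ 2)).baseChange K) (2 : ℕ))
        (cB : ℕ → galH1Torsion ((cubeSumCurve (p : ℚ)).baseChange K) (2 : ℕ)),
      (∀ ℓ, (ℓ.Prime ∧ ¬ ℓ ∣ NA ∧ ¬ ℓ ∣ NB ∧ ¬ ((ℓ : ℤ) ∣ NumberField.discr K) ∧ ℓ ≠ 2 ∧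
          (Ideal.span {(ℓ : 𝓞 K)}).IsPrime ∧
          FrobEqFrobInfty (cubeSumCurve (3 * (p : ℚ) ^ 2)) K 2 ℓ ∧
          FrobEqFrobInfty (cubeSumCurve (p : ℚ)) K 2 ℓ) →
        (∀ v : HeightOneSpectrum (𝓞 K), (ℓ : 𝓞 K) ∉ v.asIdeal →
          cA ℓ ∈ selmerLocalKer ((cubeSumCurve (3 * (p : ℚ) ^ 2)).baseChange K)
            (v.adicCompletion K) (2 : ℕ)) ∧
        (∀ x : InfinitePlace K, cA ℓ ∈ selmerLocalKer
          ((cubeSumCurve (3 * (p : ℚ) ^ 2)).baseChange K) x.Completion (2 : ℕ)) ∧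
        (∀ v : HeightOneSpectrum (𝓞 K), (ℓ : 𝓞 K) ∈ v.asIdeal →
          (cA ℓ ∈ selmerLocalKer ((cubeSumCurve (3 * (p : ℚ) ^ 2)).baseChange K)
              (v.adicCompletion K) (2 : ℕ) ↔
            kummerClassOfPoint (cubeSumCurve (p : ℚ)) K Nat.prime_two Y₀ ∈
              ((cubeSumCurve (p : ℚ)).baseChange K).torsionLocalKer (v.adicCompletion K) (2 : ℕ)))) ∧
      (∀ ℓ ℓ', (ℓ.Prime ∧ ¬ ℓ ∣ NA ∧ ¬ ℓ ∣ NB ∧ ¬ ((ℓ : ℤ) ∣ NumberField.discr K) ∧ ℓ ≠ 2 ∧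
          (Ideal.span {(ℓ : 𝓞 K)}).IsPrime ∧
          FrobEqFrobInfty (cubeSumCurve (3 * (p : ℚ) ^ 2)) K 2 ℓ ∧
          FrobEqFrobInfty (cubeSumCurve (p : ℚ)) K 2 ℓ) →
        (ℓ'.Prime ∧ ¬ ℓ' ∣ NA ∧ ¬ ℓ' ∣ NB ∧ ¬ ((ℓ' : ℤ) ∣ NumberField.discr K) ∧ ℓ' ≠ 2 ∧
          (Ideal.span {(ℓ' : 𝓞 K)}).IsPrime ∧
          FrobEqFrobInfty (cubeSumCurve (3 * (p : ℚ) ^ 2)) K 2 ℓ' ∧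
          FrobEqFrobInfty (cubeSumCurve (p : ℚ)) K 2 ℓ') → ℓ ≠ ℓ' →
        (∀ v : HeightOneSpectrum (𝓞 K), (ℓ : 𝓞 K) ∉ v.asIdeal → (ℓ' : 𝓞 K) ∉ v.asIdeal →
          cB (ℓ * ℓ') ∈ selmerLocalKer ((cubeSumCurve (p : ℚ)).baseChange K)
            (v.adicCompletion K) (2 : ℕ)) ∧
        (∀ x : InfinitePlace K,
          cB (ℓ * ℓ') ∈ selmerLocalKer ((cubeSumCurve (p : ℚ)).baseChange K) x.Completion (2 : ℕ)) ∧
        (∀ v : HeightOneSpectrum (𝓞 K), (ℓ : 𝓞 K) ∈ v.asIdeal →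
          (cB (ℓ * ℓ') ∈ selmerLocalKer ((cubeSumCurve (p : ℚ)).baseChange K)
              (v.adicCompletion K) (2 : ℕ) ↔
            cA ℓ' ∈ ((cubeSumCurve (3 * (p : ℚ) ^ 2)).baseChange K).torsionLocalKer
              (v.adicCompletion K) (2 : ℕ))))) :
    Nat.card (AddCommGroup.primaryComponent B.sha 2) = 1 ∧
      Nat.card (AddCommGroup.primaryComponent A.sha 2) = 1 := by
  haveI : Fact (Nat.Prime 2) := ⟨Nat.prime_two⟩
  have hp2 : p ≠ 2 := by rintro rfl; norm_num at hp3
  have hp0 : (p : ℚ) ≠ 0 := by exact_mod_cast hp.ne_zero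
  have h3p0 : (3 * (p : ℚ) ^ 2) ≠ 0 := mul_ne_zero (by norm_num) (pow_ne_zero 2 hp0)
  haveI := Rank1Residual.X12.CubeSumFamilies.isElliptic_cubeSumCurve hp0
  haveI := Rank1Residual.X12.CubeSumFamilies.isElliptic_cubeSumCurve h3p0
  haveI hBK : ((cubeSumCurve (p : ℚ)).baseChange K).IsElliptic :=
    inferInstanceAs ((cubeSumCurve (p : ℚ)).map (algebraMap ℚ K)).IsElliptic
  haveI hAK : ((cubeSumCurve (3 * (p : ℚ) ^ 2)).baseChange K).IsElliptic :=
    inferInstanceAs ((cubeSumCurve (3 * (p : ℚ) ^ 2)).map (algebraMap ℚ K)).IsElliptic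
  -- ### the conjugation datum `θ₀ = 2ω + 1`, `θ₀² = -3`
  have hc : (2 * ω + 1) ^ 2 = algebraMap ℚ K (-3) := by
    rw [map_neg, map_ofNat]; linear_combination 4 * hω
  have hθ₀ : 2 * ω + 1 ∉ Set.range (algebraMap ℚ K) := by
    rintro ⟨r, hr⟩
    have h1 : algebraMap ℚ K (r ^ 2) = algebraMap ℚ K (-3) := by rw [map_pow, hr, hc]
    have h3 : r ^ 2 = -3 := (algebraMap ℚ K).injective h1
    nlinarith [sq_nonneg r]
  -- ### `Y` is not `2`-divisible (Thm B′ bookkeeping), hence neither is `Y₀`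
  have hY : ¬ ∃ Q : (B.baseChange K).toAffine.Point, (2 : ℕ) • Q = Y :=
    not_exists_two_smul_eq_of_padicValRat_eq h2 hθ₀ hc hω hp hp2 B CB hCB hrank hP hgen Y hq hid hv
  set ψ : (B.baseChange K).toAffine.Point ≃+ ((cubeSumCurve (p : ℚ)).baseChange K).toAffine.Point :=
    (VariableChange.pointEquivBaseChange B CB K).trans
      (Affine.Point.congrEquiv (congrArg (fun W : WeierstrassCurve ℚ ↦ W.baseChange K) hCB)) with hψ
  have hYψ : Y₀ = ψ Y := by rw [hY₀, hψ, AddEquiv.trans_apply]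
  have hY₀' : ¬ ∃ Q : ((cubeSumCurve (p : ℚ)).baseChange K).toAffine.Point, (2 : ℕ) • Q = Y₀ := by
    rintro ⟨Q, hQ⟩
    refine hY ⟨ψ.symm Q, ψ.injective ?_⟩
    rw [map_nsmul, AddEquiv.apply_symm_apply, hQ, hYψ]
  -- ### rank on the short model; the conjugation `c`
  have hrank₀ : ((cubeSumCurve (p : ℚ)).baseChange K).mordellWeilRank = 2 :=
    mordellWeilRank_cubeSumCurve_of_variableChange B CB hCB hrank
  obtain ⟨-, -, c, hcω, -⟩ := JZero.exists_aut_apply_eq_sq K hω h2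
  -- ### leaf (L3b), with its `[ζ]`-package `w = H¹(fnB)` over `g = H¹(φB)`
  obtain ⟨φB, fnB, hfnB, -, hφB, hcoeB, h3b⟩ :=
    exists_cmH1_infinite_kolyvaginPrimes_line_sylvesterPair_of_rank (NA := NA) (NB := NB)
      hω h2 hp hp3 hcω Y₀ hY₀' hrank₀
  have hφBeq := smul_comm_of_apply_some_eq ((cubeSumCurve (p : ℚ)).baseChange K) ω φB hφB
  set w := resH1Hom (ContinuousMonoidHom.id _) fnB hfnB with hw_def
  set g := galH1Map φB hφBeq with hg_def
  have hw : ∀ x, torsionH1ToH1 ((cubeSumCurve (p : ℚ)).baseChange K) ((2 : ℕ) : ℤ) (w x) =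
      g (torsionH1ToH1 ((cubeSumCurve (p : ℚ)).baseChange K) ((2 : ℕ) : ℤ) x) :=
    fun x ↦ torsionH1ToH1_resH1Hom_id _ fnB hfnB φB hφBeq hcoeB x
  -- ### the Kolyvagin-prime predicate of the (L3) files
  set Kol : ℕ → Prop := fun ℓ ↦ ℓ.Prime ∧ ¬ ℓ ∣ NA ∧ ¬ ℓ ∣ NB ∧
      ¬ ((ℓ : ℤ) ∣ NumberField.discr K) ∧ ℓ ≠ 2 ∧ (Ideal.span {(ℓ : 𝓞 K)}).IsPrime ∧
      FrobEqFrobInfty (cubeSumCurve (3 * (p : ℚ) ^ 2)) K 2 ℓ ∧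
      FrobEqFrobInfty (cubeSumCurve (p : ℚ)) K 2 ℓ with hKol_def
  have hKol : ∀ ℓ, Kol ℓ → ℓ.Prime ∧ (Ideal.span {(ℓ : 𝓞 K)}).IsPrime :=
    fun ℓ h ↦ ⟨h.1, h.2.2.2.2.2.1⟩
  -- ### leaves (L2A), (L2B), (L3a)
  have hL2A := hL2_cubeSumCurve (K := K) h3p0 hω h2 hNA Kol
    (fun ℓ h ↦ ⟨h.1, h.2.1, h.2.2.2.1, h.2.2.2.2.1, h.2.2.2.2.2.1, h.2.2.2.2.2.2.1⟩)
  have hL2B := hL2_cubeSumCurve (K := K) hp0 hω h2 hNB Kol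
    (fun ℓ h ↦ ⟨h.1, h.2.2.1, h.2.2.2.1, h.2.2.2.2.1, h.2.2.2.2.2.1, h.2.2.2.2.2.2.2⟩)
  have hL3a := fun (s : galH1Torsion ((cubeSumCurve (3 * (p : ℚ) ^ 2)).baseChange K) ((2 : ℕ) : ℤ))
      (t : galH1Torsion ((cubeSumCurve (p : ℚ)).baseChange K) ((2 : ℕ) : ℤ)) ↦
    infinite_kolyvaginPrimes_ne_sylvesterPair (NA := NA) (NB := NB) hω h2 hp hp3 s t
  -- ### THEOREM K2 over `K`, then the Ш-currency over `ℚ`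
  obtain ⟨hK2A, hK2B⟩ := selmerGroup_eq_bot_and_le_closure_of_coupledLeaves
    (cubeSumCurve (3 * (p : ℚ) ^ 2)) (cubeSumCurve (p : ℚ)) Nat.prime_two Kol hKol hY₀' w hL1
    hL2A hL2B hL3a (fun s _ hs x hx ↦ h3b s hs x hx)
  have hCB' : CB • B = ⟨0, 0, 0, 0, -432 * (p : ℚ) ^ 2⟩ := hCB
  have hCA' : CA • A = ⟨0, 0, 0, 0, -432 * (3 * (p : ℚ) ^ 2) ^ 2⟩ := hCA
  haveI : ((⟨0, 0, 0, 0, -432 * (p : ℚ) ^ 2⟩ : WeierstrassCurve ℚ).baseChange K).IsElliptic := hBK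
  haveI : ((⟨0, 0, 0, 0, -432 * (3 * (p : ℚ) ^ 2) ^ 2⟩ : WeierstrassCurve ℚ).baseChange K).IsElliptic :=
    hAK
  exact natCard_primaryComponent_sha_eq_one_pair_of_selmer K hCA' hCB' hω h2 Nat.prime_two Y₀ w g hw
    hK2A hK2B

/-- **The HALVED form (shape of `stub_firstLayerSeven`).** As
`natCard_primaryComponent_sha_eq_one_pair_of_display_of_L1`, but the display is for `Y = 2•Y′ + T`
(`T` torsion; on `p ≡ 7 (9)` this halving is THEOREM C, crux 19802) with exponent `i` and
`ord₂ q = i + 2`, and (L1) is for the bottom class of the transport `Y₀` of `Y′`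
(`ĥ(2Y′ + T) = 4 ĥ(Y′)`, so the display for `Y′` has exponent `i + 2`). -/
theorem natCard_primaryComponent_sha_eq_one_pair_of_display_of_halving_of_L1 [NeZero (2 : ℚ)]
    (h2 : Module.finrank ℚ K = 2) {ω : K} (hω : ω ^ 2 + ω + 1 = 0) {p : ℕ} (hp : p.Prime)
    (hp3 : p % 3 = 1) (A B : WeierstrassCurve ℚ) [A.IsElliptic] [B.IsElliptic]
    (CA CB : VariableChange ℚ) (hCA : CA • A = cubeSumCurve (3 * (p : ℚ) ^ 2))
    (hCB : CB • B = cubeSumCurve (p : ℚ)) (hrank : (B.baseChange K).mordellWeilRank = 2)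
    {P : B.toAffine.Point} (hP : ¬IsOfFinAddOrder (WeierstrassCurve.QuadraticDescent.incl K B P))
    (hgen : ∀ Q : B.toAffine.Point, ∃ m : ℤ, IsOfFinAddOrder
      (WeierstrassCurve.QuadraticDescent.incl K B Q - m • WeierstrassCurve.QuadraticDescent.incl K B P))
    (Y Y' T : (B.baseChange K).toAffine.Point) (hT : IsOfFinAddOrder T) (hYY' : Y = (2 : ℤ) • Y' + T)
    {q : ℚ} (hq : q ≠ 0) {i : ℤ}
    (hid : (q : ℝ) * canonicalHeight (WeierstrassCurve.QuadraticDescent.incl K B P) =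
      (2 : ℝ) ^ i * canonicalHeight Y) (hv : padicValRat 2 q = i + 2)
    {NA NB : ℕ} [NeZero NA] [NeZero NB]
    (hNA : (cubeSumCurve (3 * (p : ℚ) ^ 2)).conductorNorm ℤ ∣ NA)
    (hNB : (cubeSumCurve (p : ℚ)).conductorNorm ℤ ∣ NB)
    (Y₀ : ((cubeSumCurve (p : ℚ)).baseChange K).toAffine.Point)
    (hY₀ : Y₀ = Affine.Point.congrEquiv (congrArg (fun W : WeierstrassCurve ℚ ↦ W.baseChange K) hCB)
      (VariableChange.pointEquivBaseChange B CB K Y'))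
    (hL1 : ∃ (cA : ℕ → galH1Torsion ((cubeSumCurve (3 * (p : ℚ) ^ 2)).baseChange K) (2 : ℕ))
        (cB : ℕ → galH1Torsion ((cubeSumCurve (p : ℚ)).baseChange K) (2 : ℕ)),
      (∀ ℓ, (ℓ.Prime ∧ ¬ ℓ ∣ NA ∧ ¬ ℓ ∣ NB ∧ ¬ ((ℓ : ℤ) ∣ NumberField.discr K) ∧ ℓ ≠ 2 ∧
          (Ideal.span {(ℓ : 𝓞 K)}).IsPrime ∧
          FrobEqFrobInfty (cubeSumCurve (3 * (p : ℚ) ^ 2)) K 2 ℓ ∧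
          FrobEqFrobInfty (cubeSumCurve (p : ℚ)) K 2 ℓ) →
        (∀ v : HeightOneSpectrum (𝓞 K), (ℓ : 𝓞 K) ∉ v.asIdeal →
          cA ℓ ∈ selmerLocalKer ((cubeSumCurve (3 * (p : ℚ) ^ 2)).baseChange K)
            (v.adicCompletion K) (2 : ℕ)) ∧
        (∀ x : InfinitePlace K, cA ℓ ∈ selmerLocalKer
          ((cubeSumCurve (3 * (p : ℚ) ^ 2)).baseChange K) x.Completion (2 : ℕ)) ∧
        (∀ v : HeightOneSpectrum (𝓞 K), (ℓ : 𝓞 K) ∈ v.asIdeal →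
          (cA ℓ ∈ selmerLocalKer ((cubeSumCurve (3 * (p : ℚ) ^ 2)).baseChange K)
              (v.adicCompletion K) (2 : ℕ) ↔
            kummerClassOfPoint (cubeSumCurve (p : ℚ)) K Nat.prime_two Y₀ ∈
              ((cubeSumCurve (p : ℚ)).baseChange K).torsionLocalKer (v.adicCompletion K) (2 : ℕ)))) ∧
      (∀ ℓ ℓ', (ℓ.Prime ∧ ¬ ℓ ∣ NA ∧ ¬ ℓ ∣ NB ∧ ¬ ((ℓ : ℤ) ∣ NumberField.discr K) ∧ ℓ ≠ 2 ∧
          (Ideal.span {(ℓ : 𝓞 K)}).IsPrime ∧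
          FrobEqFrobInfty (cubeSumCurve (3 * (p : ℚ) ^ 2)) K 2 ℓ ∧
          FrobEqFrobInfty (cubeSumCurve (p : ℚ)) K 2 ℓ) →
        (ℓ'.Prime ∧ ¬ ℓ' ∣ NA ∧ ¬ ℓ' ∣ NB ∧ ¬ ((ℓ' : ℤ) ∣ NumberField.discr K) ∧ ℓ' ≠ 2 ∧
          (Ideal.span {(ℓ' : 𝓞 K)}).IsPrime ∧
          FrobEqFrobInfty (cubeSumCurve (3 * (p : ℚ) ^ 2)) K 2 ℓ' ∧
          FrobEqFrobInfty (cubeSumCurve (p : ℚ)) K 2 ℓ') → ℓ ≠ ℓ' →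
        (∀ v : HeightOneSpectrum (𝓞 K), (ℓ : 𝓞 K) ∉ v.asIdeal → (ℓ' : 𝓞 K) ∉ v.asIdeal →
          cB (ℓ * ℓ') ∈ selmerLocalKer ((cubeSumCurve (p : ℚ)).baseChange K)
            (v.adicCompletion K) (2 : ℕ)) ∧
        (∀ x : InfinitePlace K,
          cB (ℓ * ℓ') ∈ selmerLocalKer ((cubeSumCurve (p : ℚ)).baseChange K) x.Completion (2 : ℕ)) ∧
        (∀ v : HeightOneSpectrum (𝓞 K), (ℓ : 𝓞 K) ∈ v.asIdeal →
          (cB (ℓ * ℓ') ∈ selmerLocalKer ((cubeSumCurve (p : ℚ)).baseChange K)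
              (v.adicCompletion K) (2 : ℕ) ↔
            cA ℓ' ∈ ((cubeSumCurve (3 * (p : ℚ) ^ 2)).baseChange K).torsionLocalKer
              (v.adicCompletion K) (2 : ℕ))))) :
    Nat.card (AddCommGroup.primaryComponent B.sha 2) = 1 ∧
      Nat.card (AddCommGroup.primaryComponent A.sha 2) = 1 := by
  haveI hBK : (B.baseChange K).IsElliptic := inferInstanceAs (B.map (algebraMap ℚ K)).IsElliptic
  -- the display for `Y'` with exponent `i + 2`: `ĥ(2Y' + T) = 4 ĥ(Y')`
  have hY4 : canonicalHeight Y = (2 : ℝ) ^ (2 : ℤ) * canonicalHeight Y' := by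
    rw [hYY', SylvesterTwoCMNormForm.canonicalHeight_add_of_isOfFinAddOrder _ T hT,
      canonicalHeight_zsmul_holds]
    norm_num
  have hid' : (q : ℝ) * canonicalHeight (WeierstrassCurve.QuadraticDescent.incl K B P) =
      (2 : ℝ) ^ (i + 2) * canonicalHeight Y' := by
    rw [hid, hY4, ← mul_assoc, ← zpow_add₀ (two_ne_zero' ℝ)]
  exact natCard_primaryComponent_sha_eq_one_pair_of_display_of_L1 h2 hω hp hp3 A B CA CB hCA hCB
    hrank hP hgen Y' hq hid' hv hNA hNB Y₀ hY₀ hL1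

end Summit.BirchSwinnertonDyer.BirchSwinnertonDyer.Theorems.SylvesterTwoCoupledDescentCebotarev

end
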